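import Mathlib.FieldTheory.IntermediateField.Adjoin.Basic
import Mathlib.FieldTheory.IntermediateField.Adjoin.Algebra
import Mathlib.FieldTheory.KummerPolynomial
import Mathlib.FieldTheory.Minpoly.Field
import Mathlib.RingTheory.Localization.FractionRing
import Mathlib.Algebra.CharP.Lemmas
import Mathlib.Algebra.CharP.Algebra
import HarnessLib

/-!
# Crux `Steer` (stmt-ResolutionOfSingularities-16345), chain W4.1 — the DEGREE-`p` TRANSFER
# (one missing lemma of the E2 exit `ExchangeToroidalExit` / `LogExit`, res-L0-w41-stub-1's plan)

OURS (campaign `res-hironaka`, rung L, slot W4.1, chain W4.1; unit `res-L0-w41-stub-6` carried by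
seat res-D-pv-010; helper for the frontier pieces of line `switching_dichotomy` — skeleton r12, holder
res-L0-w41-lead-1 —, namely the E2 half of `LogExit` / idea-2's `LogFinalExitM`; replaces the role of no
printed item; NOT a statement of the manuscript under review; AI-produced). Theses-free, definition-free,
pure field theory over Mathlib.

The radicand datum of the crux is `(A₀, t)` with `t ^ p ∈ A₀ ⊆ K` and `Frac (A₀[t]) = K`, so `K = F(t)`
for `F := Frac A₀ ⊆ K` and `t ^ p ∈ F`. The E2 exit re-bases the datum at an EXCHANGED radicand `t₂`
(`t₂ ∉ Frac A₀`, `t₂ ^ p` toroidal in a member of the point sequence) and runs the landed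
`stub_switchingExit`, which needs `Frac (A₁'[t₂]) = K` for the new base `A₁' ⊇ A₀`. This file proves it:

* `finrank_eq_one_or_eq_prime` — `E = F(t)`, `t ^ p ∈ F`, `p` prime, `char E = p` ⟹
  `[E : F] ∈ {1, p}` (either `t ^ p` is a `p`-th power `b ^ p` in `F`, and then `t = b ∈ F` by the
  injectivity of Frobenius, or `X ^ p − t ^ p` is irreducible over `F` (Kummer) and is the minimal
  polynomial of `t`);
* `adjoin_simple_eq_top_of_not_mem_range` — hence EVERY `t₂ ∈ E ∖ F` generates: `F(t₂) = E` (an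
  extension of prime degree has no intermediate fields, `IntermediateField.isSimpleOrder_of_finrank_prime`);
* `isFractionRing_adjoin_insert_of_not_isFracOf` — the subalgebra form the E2 assembly consumes:
  `Frac (A₀[t]) = K`, `t ^ p ∈ A₀`, `char k = p`, `t₂` NOT a fraction of elements of `A₀`, `A₀ ≤ A₁`
  ⟹ `Frac (A₁[t₂]) = K` (hypothesis `¬ IsFracOf A₀ t₂` of the skeleton vocabulary UNFOLDED verbatim:
  `¬ ∃ y ∈ A₀, ∃ z ∈ A₀, z ≠ 0 ∧ t₂ = y / z`);
* `finrank_fracField_eq_one_or_eq_prime` — `[K : Frac A₀] ∈ {1, p}` in the same frame.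

Sources: folklore (Kummer's criterion for `X ^ p − a`, prime-degree extensions are simple orders).
[cite: Lang2002, Ch. VI Thm. 9.1] [folklore]
-/

-- layout-mandated namespace `Summit.<Summit>.<Problem>.…` with Summit = Problem (single-conjunct summit)
set_option linter.dupNamespace false

namespace Summit.ResolutionOfSingularities.ResolutionOfSingularities.Theorems.SwitchingDichotomy

namespace DegreePTransfer

open Polynomial IntermediateField

section FieldTheory

variable {F E : Type*} [Field F] [Field E] [Algebra F E]

/-- **`[F(t) : F] ∈ {1, p}` for `t ^ p ∈ F`.** If `E = F(t)` with `t ^ p ∈ F`, `p` prime and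
`char E = p`, then `[E : F] = 1` or `[E : F] = p`: either `t ^ p = b ^ p` for some `b ∈ F`, and then
`(t − b) ^ p = 0` forces `t = b ∈ F`; or `X ^ p − t ^ p` has no root in `F`, is irreducible (Kummer)
and is the minimal polynomial of `t`. [cite: Lang2002, Ch. VI Thm. 9.1] [folklore] -/
theorem finrank_eq_one_or_eq_prime {p : ℕ} (hp : p.Prime) [CharP E p] {t : E}
    (ht : t ^ p ∈ Set.range (algebraMap F E)) (htop : F⟮t⟯ = ⊤) :
    Module.finrank F E = 1 ∨ Module.finrank F E = p := by
  obtain ⟨a, ha⟩ := ht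
  have hmonic : (X ^ p - C a : F[X]).Monic := monic_X_pow_sub_C a hp.ne_zero
  have haeval : aeval t (X ^ p - C a : F[X]) = 0 := by
    simp only [map_sub, map_pow, aeval_X, aeval_C, ha, sub_self]
  have hint : IsIntegral F t := isAlgebraic_iff_isIntegral.mp ⟨_, hmonic.ne_zero, haeval⟩
  have hfin : Module.finrank F E = (minpoly F t).natDegree := by
    rw [← finrank_top', ← htop, adjoin.finrank hint]
  by_cases hb : ∃ b : F, b ^ p = a
  · -- `t ∈ F`
    obtain ⟨b, hb⟩ := hb
    haveI := Fact.mk hp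
    have h0 : (t - algebraMap F E b) ^ p = 0 := by
      rw [sub_pow_char t (algebraMap F E b), ← map_pow, hb, ha, sub_self]
    have htb : t = algebraMap F E b := sub_eq_zero.mp ((pow_eq_zero_iff hp.ne_zero).mp h0)
    left
    rw [hfin, htb, minpoly.eq_X_sub_C, natDegree_X_sub_C]
  · -- `X ^ p - a` irreducible
    right
    push Not at hb
    have hirr : Irreducible (X ^ p - C a : F[X]) := (X_pow_sub_C_irreducible_iff_of_prime hp).mpr hb
    rw [hfin, ← minpoly.eq_of_irreducible_of_monic hirr haeval hmonic, natDegree_X_pow_sub_C]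

/-- **Prime degree: every element outside `F` generates.** If `E = F(t)` with `t ^ p ∈ F`, `p` prime,
`char E = p`, and `t₂ ∈ E` is NOT in `F`, then `F(t₂) = E`: by `finrank_eq_one_or_eq_prime` the degree
is `p` (it is not `1`, as `t₂ ∉ F`), and an extension of prime degree has only the two trivial
intermediate fields. [cite: Lang2002, Ch. VI Thm. 9.1] [folklore] -/
theorem adjoin_simple_eq_top_of_not_mem_range {p : ℕ} (hp : p.Prime) [CharP E p] {t : E}
    (ht : t ^ p ∈ Set.range (algebraMap F E)) (htop : F⟮t⟯ = ⊤) {t₂ : E}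
    (ht₂ : t₂ ∉ Set.range (algebraMap F E)) : F⟮t₂⟯ = ⊤ := by
  have hbot : t₂ ∉ (⊥ : IntermediateField F E) := fun h => ht₂ (IntermediateField.mem_bot.mp h)
  rcases finrank_eq_one_or_eq_prime hp ht htop with h1 | hP
  · exact absurd (show t₂ ∈ (⊥ : IntermediateField F E) by
      rw [bot_eq_top_iff_finrank_eq_one.mpr h1]; exact mem_top) hbot
  · haveI := IntermediateField.isSimpleOrder_of_finrank_prime F E (hP ▸ hp)
    exact (IsSimpleOrder.eq_bot_or_eq_top F⟮t₂⟯).resolve_left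
      fun h => hbot (adjoin_simple_eq_bot_iff.mp h)

end FieldTheory

section Subalgebra

variable {k K : Type*} [Field k] [Field K] [Algebra k K]

/-- The intermediate field generated by a subalgebra `A₀ ⊆ K` consists of the fractions `y / z` of
elements of `A₀` (`z ≠ 0`) — the skeleton's `IsFracOf A₀`, unfolded. [folklore] -/
theorem exists_div_of_mem_adjoin (A₀ : Subalgebra k K) {x : K}
    (hx : x ∈ IntermediateField.adjoin k (A₀ : Set K)) :
    ∃ y ∈ A₀, ∃ z ∈ A₀, z ≠ 0 ∧ x = y / z := by
  rw [IntermediateField.mem_adjoin_iff_div, Algebra.adjoin_eq] at hx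
  obtain ⟨r, hr, s, hs, rfl⟩ := hx
  by_cases hs0 : s = 0
  · exact ⟨0, A₀.zero_mem, 1, A₀.one_mem, one_ne_zero, by simp [hs0]⟩
  · exact ⟨r, hr, s, hs, hs0, rfl⟩

/-- Conversely, fractions of elements of `A₀` lie in the intermediate field it generates. [folklore] -/
theorem mem_adjoin_of_exists_div (A₀ : Subalgebra k K) {x : K}
    (hx : ∃ y ∈ A₀, ∃ z ∈ A₀, z ≠ 0 ∧ x = y / z) :
    x ∈ IntermediateField.adjoin k (A₀ : Set K) := by
  obtain ⟨y, hy, z, hz, -, rfl⟩ := hx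
  exact div_mem (IntermediateField.subset_adjoin k _ hy) (IntermediateField.subset_adjoin k _ hz)

/-- `Frac (A₀[t]) = K` (as `IsFractionRing` of the subalgebra `A₀[t]`) says that `A₀ ∪ {t}` generates
`K` as a field over `k`. [folklore] -/
theorem adjoin_insert_eq_top_of_isFractionRing (A₀ : Subalgebra k K) (t : K)
    (hfr : IsFractionRing (Algebra.adjoin k (insert t (A₀ : Set K))) K) :
    IntermediateField.adjoin k (insert t (A₀ : Set K)) = ⊤ := by
  rw [eq_top_iff]
  intro x _
  obtain ⟨a, b, -, rfl⟩ :=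
    IsFractionRing.div_surjective (A := Algebra.adjoin k (insert t (A₀ : Set K))) x
  exact div_mem (IntermediateField.algebra_adjoin_le_adjoin k _ a.2)
    (IntermediateField.algebra_adjoin_le_adjoin k _ b.2)

/-- Conversely, if `A₀ ∪ {t}` generates `K` as a field over `k`, then `Frac (A₀[t]) = K`. [folklore] -/
theorem isFractionRing_of_adjoin_insert_eq_top (A₀ : Subalgebra k K) (t : K)
    (h : IntermediateField.adjoin k (insert t (A₀ : Set K)) = ⊤) :
    IsFractionRing (Algebra.adjoin k (insert t (A₀ : Set K))) K := by
  refine IsFractionRing.of_field _ K fun z => ?_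
  have hz : z ∈ IntermediateField.adjoin k (insert t (A₀ : Set K)) := by
    rw [h]
    exact IntermediateField.mem_top
  obtain ⟨r, hr, s, hs, rfl⟩ := IntermediateField.mem_adjoin_iff_div.mp hz
  exact ⟨⟨r, hr⟩, ⟨s, hs⟩, rfl⟩

/-- In the crux frame `K = F(t)` for the intermediate field `F = Frac A₀` generated by `A₀`, when
`Frac (A₀[t]) = K`. [folklore] -/
theorem adjoin_fracField_simple_eq_top (A₀ : Subalgebra k K) (t : K)
    (hfr : IsFractionRing (Algebra.adjoin k (insert t (A₀ : Set K))) K) :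
    (IntermediateField.adjoin k (A₀ : Set K))⟮t⟯ = ⊤ := by
  rw [← IntermediateField.restrictScalars_eq_top_iff (K := k), IntermediateField.adjoin_adjoin_left,
    Set.union_comm, ← Set.insert_eq]
  exact adjoin_insert_eq_top_of_isFractionRing A₀ t hfr

/-- **`[K : Frac A₀] ∈ {1, p}`** in the crux frame: `t ^ p ∈ A₀`, `Frac (A₀[t]) = K`, `char k = p`
prime. [cite: Lang2002, Ch. VI Thm. 9.1] [folklore] -/
theorem finrank_fracField_eq_one_or_eq_prime {p : ℕ} (hp : p.Prime) [CharP k p]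
    (A₀ : Subalgebra k K) (t : K) (htp : t ^ p ∈ A₀)
    (hfr : IsFractionRing (Algebra.adjoin k (insert t (A₀ : Set K))) K) :
    Module.finrank (IntermediateField.adjoin k (A₀ : Set K)) K = 1 ∨
      Module.finrank (IntermediateField.adjoin k (A₀ : Set K)) K = p := by
  haveI : CharP K p := charP_of_injective_algebraMap (algebraMap k K).injective p
  exact finrank_eq_one_or_eq_prime hp
    ⟨⟨t ^ p, IntermediateField.subset_adjoin k _ htp⟩, rfl⟩ (adjoin_fracField_simple_eq_top A₀ t hfr)

/-- **Degree-`p` transfer** (the one missing lemma of res-L0-w41-stub-1's E2 plan, chain W4.1). In the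
crux frame — `t ^ p ∈ A₀`, `Frac (A₀[t]) = K`, `char k = p` prime — every `t₂ ∈ K` that is NOT a
fraction of elements of `A₀` (the skeleton's `¬ IsFracOf A₀ t₂`, unfolded) generates `K` over
`Frac A₀`; hence `Frac (A₁[t₂]) = K` for EVERY subalgebra `A₁ ⊇ A₀` (in the E2 exit: the finitely
generated model `A₁'` of the member `R N` carrying the toroidal radicand `t₂ ^ p`). Proof:
`[K : Frac A₀] ∈ {1, p}`, it is not `1` since `t₂ ∉ Frac A₀`, and a prime-degree extension has no proper
intermediate field. [cite: Lang2002, Ch. VI Thm. 9.1] [folklore] -/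
theorem isFractionRing_adjoin_insert_of_not_isFracOf {p : ℕ} (hp : p.Prime) [CharP k p]
    (A₀ : Subalgebra k K) (t : K) (htp : t ^ p ∈ A₀)
    (hfr : IsFractionRing (Algebra.adjoin k (insert t (A₀ : Set K))) K)
    (t₂ : K) (ht₂ : ¬ ∃ y ∈ A₀, ∃ z ∈ A₀, z ≠ 0 ∧ t₂ = y / z)
    (A₁ : Subalgebra k K) (hle : A₀ ≤ A₁) :
    IsFractionRing (Algebra.adjoin k (insert t₂ (A₁ : Set K))) K := by
  haveI : CharP K p := charP_of_injective_algebraMap (algebraMap k K).injective p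
  set F : IntermediateField k K := IntermediateField.adjoin k (A₀ : Set K) with hF
  -- `t₂ ∉ F`
  have ht₂' : t₂ ∉ Set.range (algebraMap F K) := by
    rintro ⟨y, rfl⟩
    exact ht₂ (exists_div_of_mem_adjoin A₀ y.2)
  -- `F(t₂) = K`
  have htop : F⟮t₂⟯ = ⊤ :=
    adjoin_simple_eq_top_of_not_mem_range hp ⟨⟨t ^ p, IntermediateField.subset_adjoin k _ htp⟩, rfl⟩
      (adjoin_fracField_simple_eq_top A₀ t hfr) ht₂'
  -- i.e. `A₀ ∪ {t₂}` generates `K` over `k`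
  have htop' : IntermediateField.adjoin k (insert t₂ (A₀ : Set K)) = ⊤ := by
    rw [Set.insert_eq, Set.union_comm, ← IntermediateField.adjoin_adjoin_left,
      IntermediateField.restrictScalars_eq_top_iff]
    exact htop
  -- fractions
  refine IsFractionRing.of_field _ K fun z => ?_
  have hz : z ∈ IntermediateField.adjoin k (insert t₂ (A₀ : Set K)) := by
    rw [htop']
    exact IntermediateField.mem_top
  obtain ⟨r, hr, s, hs, rfl⟩ := IntermediateField.mem_adjoin_iff_div.mp hz
  have hmono : Algebra.adjoin k (insert t₂ (A₀ : Set K)) ≤ Algebra.adjoin k (insert t₂ (A₁ : Set K)) :=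
    Algebra.adjoin_mono (Set.insert_subset_insert fun x hx => hle hx)
  exact ⟨⟨r, hmono hr⟩, ⟨s, hmono hs⟩, rfl⟩

/-- **Degree-`p` transfer, base form** (`A₁ = A₀`): `Frac (A₀[t₂]) = K` for every non-fraction `t₂`.
[cite: Lang2002, Ch. VI Thm. 9.1] [folklore] -/
theorem isFractionRing_adjoin_insert_of_not_isFracOf_self {p : ℕ} (hp : p.Prime) [CharP k p]
    (A₀ : Subalgebra k K) (t : K) (htp : t ^ p ∈ A₀)
    (hfr : IsFractionRing (Algebra.adjoin k (insert t (A₀ : Set K))) K)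
    (t₂ : K) (ht₂ : ¬ ∃ y ∈ A₀, ∃ z ∈ A₀, z ≠ 0 ∧ t₂ = y / z) :
    IsFractionRing (Algebra.adjoin k (insert t₂ (A₀ : Set K))) K :=
  isFractionRing_adjoin_insert_of_not_isFracOf hp A₀ t htp hfr t₂ ht₂ A₀ le_rfl

/-- **Dichotomy for an arbitrary second radicand** (bookkeeping for the E2 assembly): in the crux frame,
ANY `t₂ ∈ K` is either a fraction of elements of `A₀` (`IsFracOf A₀ t₂`, unfolded) or generates `K`
over every `A₁ ⊇ A₀`: `Frac (A₁[t₂]) = K`. Pure logic over the transfer. [folklore] -/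
theorem isFracOf_or_isFractionRing_adjoin_insert {p : ℕ} (hp : p.Prime) [CharP k p]
    (A₀ : Subalgebra k K) (t : K) (htp : t ^ p ∈ A₀)
    (hfr : IsFractionRing (Algebra.adjoin k (insert t (A₀ : Set K))) K) (t₂ : K)
    (A₁ : Subalgebra k K) (hle : A₀ ≤ A₁) :
    (∃ y ∈ A₀, ∃ z ∈ A₀, z ≠ 0 ∧ t₂ = y / z) ∨
      IsFractionRing (Algebra.adjoin k (insert t₂ (A₁ : Set K))) K := by
  by_cases h : ∃ y ∈ A₀, ∃ z ∈ A₀, z ≠ 0 ∧ t₂ = y / z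
  · exact Or.inl h
  · exact Or.inr (isFractionRing_adjoin_insert_of_not_isFracOf hp A₀ t htp hfr t₂ h A₁ hle)

end Subalgebra

end DegreePTransfer

end Summit.ResolutionOfSingularities.ResolutionOfSingularities.Theorems.SwitchingDichotomy
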